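import Summits.CriticalPhenomena.PercolationContinuityZ3.Theorems.Transplant.PlanarSkeletonConcDefs
import Summits.CriticalPhenomena.PercolationContinuityZ3.Theorems.Transplant.PlanarSkeletonBoxProd
import Summits.CriticalPhenomena.PercolationContinuityZ3.Theorems.Transplant.BoxProdSlabQuotient
import HarnessLib

/-!
# Cartesian products inherit the design-(D) interface: `PlanarSkeletonConc Y → PlanarSkeletonConc (X □ Y)` for connected quasi-transitive `X`,
# and Benjamini–Schramm's Conjecture 4 for `X □ Y` from the node of record `SamePDropOfSkeletonConcLt`

builds on p205010 (kernel theorem, internal audit signed; external expert review pending) — nothing in this file uses p205010.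
Status sentence (coordinator 2026-08-20T04:30Z): "θ(p_c) = 0 on ℤ^d, all d ≥ 2 — kernel-verified (Lean 4/Mathlib, standard axioms);
internal adversarial audit SIGNED 2026-08-20 04:29Z; external expert review pending."

Lane `prim-bschramm`, seat `prim-bschramm-p4` (gen 5; class map, memo `P4-GENERAL.md` §13), helper file
(`--supports stmt-CriticalPhenomena-4575`).  Generic product rung for the interface `PlanarSkeletonConc` (stmt-g6, p229853; node of record
`SamePDropOfSkeletonConcLt`, p230105): p4 gen 3's `PlanarSkeleton.boxProdLeft` (φ = Φ.φ ∘ Prod.snd, base vertices `V₀ × Φ.types`, cylinders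
`X × cyl`) upgraded with the three (D)-fields —
(μ) `degree_{X □ Y}(x, y) = degree_X x + degree_Y y ≤ D_X + Φ.Δ` (Mathlib `degree_boxProd`; `D_X` from quasi-transitivity,
`IsQuasiTransitive.exists_degree_le`), (ι) outward steps inside the `Y`-slice `{x} × Y` (`Φ.step`), (κ) the induced cylinder graph on
`X × Φ.cyl t ℓ` is connected when `X` is connected and `Y[Φ.cyl t ℓ]` is (`induce_univ_prod_connected`: `X`-walks in a slice `X × {y}`,
then a walk of `Y[cyl]` in the slice `{x'} × cyl`).

* `induce_univ_prod_connected` — `X` connected, `Y[S]` connected ⇒ `(X □ Y)[X × S]` connected;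
* `PlanarSkeletonConc.boxProdLeft X hq hc Φ : PlanarSkeletonConc (X □ Y)`, `toPlanarSkeleton_boxProdLeft` (`rfl` to p4-g3's skeleton);
* **`bsConj4_boxProd_of_skeletonConcNode`** — for `X` connected, locally finite, quasi-transitive and `Y` connected, locally finite,
  quasi-transitive of polynomial growth with `p_c(Y) < 1`, carrying `Φ : PlanarSkeletonConc Y` whose PRODUCT cylinders are subcritical at
  `p_c(X □ Y)`: the node of record gives `θ_{X □ Y}(v, p_c) = 0` at every vertex (growth dichotomy: `X` of exponential growth ⇒ Hutchcroft
  outright; else `X □ Y` amenable ⇒ Burton–Keane uniqueness ⇒ node at a base vertex ⇒ every vertex by connectivity).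
Instances (next file of the series): `X □ H₃(ℤ)`, `X □ (H₃(ℤ) × ℤ)`, `X □ H_{2k+1}(ℤ)`.  Nothing is claimed about the node.
[cite: BenjaminiSchramm1996, §2 (almost transitive graphs) and Conj. 4] [cite: LyonsPeres2016, §6.1 (p. 279); Thm. 7.6] [cite: Hutchcroft2016, Thm. 1]
[cite: KozmaNitzan2024, §4 p. 15 (boxes and symmetries); §1 p. 2 (approach 1)]
-/

noncomputable section

namespace Summit.CriticalPhenomena.PercolationContinuityZ3.Theorems.Transplant

open MeasureTheory Literature.Probability.Percolation Literature.Probability.LatticeModels SimpleGraph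
open Literature.Barriers.CriticalPhenomena (IsQuasiTransitive IsGraphAmenable HasExponentialGrowth ballVolume
  countable_of_connected_of_locallyFinite)

variable {W U : Type}

/-! ## §1 Connectivity of `(X □ Y)[X × S]` -/

/-- The slice `X × {y}` (`y ∈ S`) maps `X` homomorphically into `(X □ Y)[X × S]`. [folklore] -/
def sliceLeftHom (X : SimpleGraph W) (Y : SimpleGraph U) (S : Set U) {y : U} (hy : y ∈ S) :
    X →g (X □ Y).induce ((Set.univ : Set W) ×ˢ S) where
  toFun w := ⟨(w, y), Set.mk_mem_prod (Set.mem_univ w) hy⟩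
  map_rel' := fun {a b} hab => by
    change (X □ Y).Adj (a, y) (b, y)
    exact (boxProd_adj (x := (a, y)) (y := (b, y))).2 (Or.inl ⟨hab, rfl⟩)

/-- The slice `{x} × S` maps `Y[S]` homomorphically into `(X □ Y)[X × S]`. [folklore] -/
def sliceRightHom (X : SimpleGraph W) (Y : SimpleGraph U) (S : Set U) (x : W) :
    Y.induce S →g (X □ Y).induce ((Set.univ : Set W) ×ˢ S) where
  toFun u := ⟨(x, (u : U)), Set.mk_mem_prod (Set.mem_univ x) u.2⟩
  map_rel' := fun {a b} hab => by
    change (X □ Y).Adj (x, (a : U)) (x, (b : U))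
    exact (boxProd_adj (x := (x, (a : U))) (y := (x, (b : U)))).2 (Or.inr ⟨induce_adj.1 hab, rfl⟩)

/-- **`(X □ Y)[X × S]` is connected when `X` is connected and `Y[S]` is connected** (interface field (κ) for products: the cylinders of the
product skeleton are `X × (cylinder of Φ)`). [folklore] -/
theorem induce_univ_prod_connected (X : SimpleGraph W) (Y : SimpleGraph U) {S : Set U} (hX : X.Connected) (hS : (Y.induce S).Connected) :
    ((X □ Y).induce ((Set.univ : Set W) ×ˢ S)).Connected := by
  obtain ⟨⟨y₀, hy₀⟩⟩ := hS.nonempty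
  obtain ⟨x₀⟩ := hX.nonempty
  refine { preconnected := fun u v => ?_, nonempty := ⟨⟨(x₀, y₀), Set.mk_mem_prod (Set.mem_univ x₀) hy₀⟩⟩ }
  obtain ⟨⟨x, y⟩, hxy⟩ := u
  obtain ⟨⟨x', y'⟩, hxy'⟩ := v
  have hy : y ∈ S := (Set.mem_prod.1 hxy).2
  have hy' : y' ∈ S := (Set.mem_prod.1 hxy').2
  have r1 : ((X □ Y).induce ((Set.univ : Set W) ×ˢ S)).Reachable ⟨(x, y), hxy⟩ ⟨(x', y), Set.mk_mem_prod (Set.mem_univ x') hy⟩ :=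
    (hX.preconnected x x').map (sliceLeftHom X Y S hy)
  have r2 : ((X □ Y).induce ((Set.univ : Set W) ×ˢ S)).Reachable ⟨(x', y), Set.mk_mem_prod (Set.mem_univ x') hy⟩ ⟨(x', y'), hxy'⟩ :=
    (hS.preconnected ⟨y, hy⟩ ⟨y', hy'⟩).map (sliceRightHom X Y S x')
  exact r1.trans r2

/-! ## §2 The product interface -/

/-- **The design-(D) interface passes to `X □ Y`** (`X` connected, locally finite, quasi-transitive): p4 gen 3's product skeleton
`Φ.boxProdLeft X hq` + degree bound `D_X + Φ.Δ` + outward steps in the `Y`-slices + connected cylinders `X × cyl`.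
[cite: BenjaminiSchramm1996, §2 (almost transitive graphs)] [cite: KozmaNitzan2024, §4 p. 15] -/
def PlanarSkeletonConc.boxProdLeft (X : SimpleGraph W) [X.LocallyFinite] (hq : IsQuasiTransitive X) (hc : X.Connected)
    {Y : SimpleGraph U} [Y.LocallyFinite] (Φ : PlanarSkeletonConc Y) : PlanarSkeletonConc (X □ Y) where
  toPlanarSkeleton := Φ.toPlanarSkeleton.boxProdLeft X hq
  Δ := Classical.choose hq.exists_degree_le + Φ.Δ
  degree_le := fun v => by
    classical
    rw [degree_boxProd]
    exact add_le_add (Classical.choose_spec hq.exists_degree_le v.1) (Φ.degree_le v.2)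
  step := fun v i σ => by
    obtain ⟨u', hadj, hu'⟩ := Φ.step v.2 i σ
    exact ⟨(v.1, u'), (boxProd_adj (x := v) (y := (v.1, u'))).2 (Or.inr ⟨hadj, rfl⟩), hu'⟩
  cyl_connected := fun t ht ℓ hℓ => by
    have ht2 : t.2 ∈ Φ.types := ((PlanarSkeleton.mem_types_boxProdLeft X hq Φ.toPlanarSkeleton t).1 ht).2
    have e : {w : W × U | (Φ.toPlanarSkeleton.boxProdLeft X hq).φ w - (Φ.toPlanarSkeleton.boxProdLeft X hq).φ t ∈ box 2 ℓ} =
        (Set.univ : Set W) ×ˢ {u : U | Φ.φ u - Φ.φ t.2 ∈ box 2 ℓ} :=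
      PlanarSkeleton.cyl_boxProdLeft X hq Φ.toPlanarSkeleton t ℓ
    rw [e]
    exact induce_univ_prod_connected X Y hc (Φ.cyl_connected t.2 ht2 ℓ hℓ)

/-- The underlying planar skeleton is p4 gen 3's product skeleton. [folklore] -/
@[simp] theorem PlanarSkeletonConc.toPlanarSkeleton_boxProdLeft (X : SimpleGraph W) [X.LocallyFinite] (hq : IsQuasiTransitive X)
    (hc : X.Connected) {Y : SimpleGraph U} [Y.LocallyFinite] (Φ : PlanarSkeletonConc Y) :
    (Φ.boxProdLeft X hq hc).toPlanarSkeleton = Φ.toPlanarSkeleton.boxProdLeft X hq := rfl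

/-! ## §3 Conjecture 4 for `X □ Y` from the node of record -/

/-- **Benjamini–Schramm's Conjecture 4 for `X □ Y` from the node of record `SamePDropOfSkeletonConcLt`** (NOT proved, never asserted):
`X` connected, locally finite, quasi-transitive; `Y` connected, locally finite, quasi-transitive, of polynomial growth `|B_Y(y,n)| ≤ (2n+1)^D`,
with `p_c(Y) < 1` and a `PlanarSkeletonConc` whose product cylinders `X × cyl` are subcritical at `p_c(X □ Y)` at the base vertices ⟹
`θ_{X □ Y}(v, p_c) = 0` at every vertex.  Growth dichotomy: `X` of exponential growth — Hutchcroft's theorem outright; otherwise `X □ Y` is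
amenable, the infinite cluster is unique (Burton–Keane) and the node applies at a base vertex (`p_c(X □ Y) ≤ p_c(Y) < 1`).  Conditional on the
node only. [cite: BenjaminiSchramm1996, Conj. 4] [cite: Hutchcroft2016, Thm. 1] [cite: LyonsPeres2016, Thm. 7.6] [cite: KozmaNitzan2024, §1 p. 2 (approach 1)] -/
theorem bsConj4_boxProd_of_skeletonConcNode (hD : SamePDropOfSkeletonConcLt) [DecidableEq W] [DecidableEq U] (X : SimpleGraph W)
    [X.LocallyFinite] (hcX : X.Connected) (hqX : IsQuasiTransitive X) {Y : SimpleGraph U} [Y.LocallyFinite] (Φ : PlanarSkeletonConc Y)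
    (hcY : Y.Connected) (hqY : IsQuasiTransitive Y) (D : ℕ) (hY : ∀ (y : U) (n : ℕ), ballVolume Y y n ≤ (2 * n + 1) ^ D)
    {y₀ : U} (hpcY : criticalProb Y y₀ < 1)
    (hC : ∀ t ∈ (Φ.toPlanarSkeleton.boxProdLeft X hqX).types,
      (Φ.toPlanarSkeleton.boxProdLeft X hqX).CylSubcritical (criticalProbIOf (X □ Y) t))
    (v : W × U) : theta (X □ Y) v (criticalProbIOf (X □ Y) v) = 0 := by
  classical
  by_cases hg : HasExponentialGrowth X
  · exact theta_boxProd_criticalProb_eq_zero_of_expGrowth X Y hcX hcY hqX hqY hg v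
  · haveI : Nonempty U := ⟨y₀⟩
    have hconn : (X □ Y).Connected := hcX.boxProd hcY
    haveI : Countable W := countable_of_connected_of_locallyFinite X hcX v.1
    haveI : Countable U := countable_of_connected_of_locallyFinite Y hcY y₀
    have ha : IsGraphAmenable (X □ Y) := isGraphAmenable_boxProd_of_polyGrowth X Y hqX hqY D hY hg
    obtain ⟨t, ht, -⟩ := (Φ.toPlanarSkeleton.boxProdLeft X hqX).frame v
    have hpc : criticalProb (X □ Y) t < 1 :=
      calc criticalProb (X □ Y) t = criticalProb (X □ Y) (t.1, t.2) := rfl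
        _ ≤ criticalProb Y t.2 := criticalProb_boxProd_le_right X Y t.1 t.2
        _ = criticalProb Y y₀ := criticalProb_eq_of_reachable Y (hcY.preconnected _ _)
        _ < 1 := hpcY
    have h0 : theta (X □ Y) t (criticalProbIOf (X □ Y) t) = 0 :=
      continuity_of_skeletonConcLt_drop_amenable hD (X □ Y) (Φ.boxProdLeft X hqX hcX) hconn (isQuasiTransitive_boxProd hqX hqY) ha
        t ht hpc (hC t ht)
    exact theta_criticalProbIOf_eq_zero_of_reachable (X □ Y) (hconn.preconnected _ _) h0

end Summit.CriticalPhenomena.PercolationContinuityZ3.Theorems.Transplant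

end
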